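import Summits.NavierStokesRegularity.NavierStokesRegularity.Theorems.ExtremiserTransienceNearExtremalTransienceExtremiserLiouvilleNewtonGradientBound
import Literature.Analysis.FluidPDE.ClassicalLerayProjection
import HarnessLib

/-!
# Crux `ExtremiserTransience.NearExtremalTransience` (stmt-NavierStokesRegularity-21883), line `extremiser_liouville`,
# stub K1b — the ANISOTROPIC sup bound for the Newtonian gradient: `‖∇(Γ∗φ)(y)‖ ≤ A·ρ + (2π)⁻¹∫|φ(x)|/(ρ² + (x₂−y₂)²)dx`

`--supports stmt-NavierStokesRegularity-21883` (helper).  Author: prover seat `ns-el-k1b` (g7).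

The corrector of the far-field Caccioppoli inequality (`…ConstantSpeedFarCaccioppoli`, `…ConstantSpeedCrossTermsAssembly`)
costs `κ⋆(1+κ⋆)MZW·η`, `η = sup‖∇π[θV]‖`, `π[θV] = Γ ∗ div(θV)`.  The tree's isotropic interpolation
`‖∇(Γ∗φ)‖_∞ ≤ A R + √(∫φ²/(4πR))` (`…NewtonGradientBound`) only gives `η = O(R^{-2/3})` for a cut-off at scale `R`.
For AXIAL cut-offs `θ = g(x₂)` of the constant-speed residue the source `φ = div(gV) = g′(x₂)V₂ = −g′‖V‖²/(2M)` is QUADRATIC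
in `V` and, by the energy-flux invariance, has bounded mass PER UNIT HEIGHT (`∫_{x₂ = z}‖V‖² ≡ E₀`); the right tool is then
the anisotropic bound of this file, whose far part only sees the per-height mass:

* `norm_sub_sq_ge_half` — off the ball `B(y, ρ)`: `‖y − x‖² ≥ (ρ² + (x₂ − y₂)²)/2`;
* `norm_fderiv_newtonPotential_le_anisotropic` — for `φ ∈ C^∞_c(ℝ³)`, `|φ| ≤ A`, `ρ > 0`, every `y`:
  **`‖D(Γ ∗ φ)(y)‖ ≤ A·ρ + (2π)⁻¹·∫ |φ(x)|·(ρ² + (x₂ − y₂)²)⁻¹ dx`** (near field `≤ (4π)⁻¹A∫_{B(y,ρ)}|y−x|⁻² = Aρ`,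
  far field by `|y−x|⁻² ≤ 2(ρ² + (x₂−y₂)²)⁻¹`);
* `norm_gradient_divPotential_le_anisotropic` — the same for `∇π[G] = ∇(Γ ∗ div G)`, `G ∈ C^∞_c(ℝ³;ℝ³)`.

WHAT THIS IS NOT: K1b is NOT proved; nothing here proves NS regularity. [folklore]
-/

noncomputable section

open MeasureTheory Set Function Filter Metric Real
open _root_.Topology
open scoped ENNReal NNReal InnerProductSpace RealInnerProductSpace

namespace Summit.NavierStokesRegularity.NavierStokesRegularity.Theorems

-- the problem directory repeats the summit name (`NavierStokesRegularity/NavierStokesRegularity`)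
set_option linter.dupNamespace false

namespace ExtremiserLiouville

open Literature.Analysis.FluidPDE

variable {φ : EuclideanSpace ℝ (Fin 3) → ℝ}

/-- Off the ball `B(y,ρ)` the squared distance dominates half of `ρ² + (x₂ − y₂)²`. [folklore] -/
theorem norm_sub_sq_ge_half {y x : EuclideanSpace ℝ (Fin 3)} {ρ : ℝ} (hρ : 0 ≤ ρ) (hx : ρ ≤ ‖y - x‖) :
    (ρ ^ 2 + (x 2 - y 2) ^ 2) / 2 ≤ ‖y - x‖ ^ 2 := by
  have h1 : ρ ^ 2 ≤ ‖y - x‖ ^ 2 := pow_le_pow_left₀ hρ hx 2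
  have h2 : (x 2 - y 2) ^ 2 ≤ ‖y - x‖ ^ 2 := by
    have h := EuclideanSpace.norm_sq_eq (y - x)
    have hcoord : (y - x) 2 = y 2 - x 2 := rfl
    rw [h]
    have hle : ‖(y - x) 2‖ ^ 2 ≤ ∑ i, ‖(y - x) i‖ ^ 2 :=
      Finset.single_le_sum (f := fun i => ‖(y - x) i‖ ^ 2) (fun i _ => sq_nonneg _) (Finset.mem_univ (2 : Fin 3))
    rw [hcoord, Real.norm_eq_abs, sq_abs] at hle
    calc (x 2 - y 2) ^ 2 = (y 2 - x 2) ^ 2 := by ring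
      _ ≤ _ := hle
  linarith

/-- **THE ANISOTROPIC SUP BOUND FOR THE NEWTONIAN GRADIENT.**  For `φ ∈ C^∞_c(ℝ³)` with `|φ| ≤ A`, every `ρ > 0` and
`y ∈ ℝ³`:  `‖D(Γ ∗ φ)(y)‖ ≤ A·ρ + (2π)⁻¹·∫ |φ(x)|·(ρ² + (x₂ − y₂)²)⁻¹ dx`. [folklore] -/
theorem norm_fderiv_newtonPotential_le_anisotropic (hφ : ContDiff ℝ (⊤ : ℕ∞) φ) (hφc : HasCompactSupport φ)
    {A : ℝ} (hA : ∀ x, |φ x| ≤ A) {ρ : ℝ} (hρ : 0 < ρ) (y : EuclideanSpace ℝ (Fin 3)) :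
    ‖fderiv ℝ (fun y => ∫ x, newtonKernel (y - x) * φ x) y‖ ≤
      A * ρ + (2 * π)⁻¹ * ∫ x, |φ x| * (ρ ^ 2 + (x 2 - y 2) ^ 2)⁻¹ := by
  set G : EuclideanSpace ℝ (Fin 3) := ∫ x, φ x • ((4 * π * ‖y - x‖ ^ 3)⁻¹ • (y - x)) with hG
  have hA0 : 0 ≤ A := (abs_nonneg _).trans (hA y)
  -- the gradient is represented by `G`
  have hrep : ∀ a, fderiv ℝ (fun y => ∫ x, newtonKernel (y - x) * φ x) y a = ⟪G, a⟫ := fun a =>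
    (inner_integral_smul_newtonGradVec_eq_fderiv hφ hφc y a).symm
  -- the far weight
  set w : EuclideanSpace ℝ (Fin 3) → ℝ := fun x => (ρ ^ 2 + (x 2 - y 2) ^ 2)⁻¹ with hw
  have hw0 : ∀ x, 0 ≤ w x := fun x => by positivity
  have hwle : ∀ x, w x ≤ (ρ ^ 2)⁻¹ := fun x => by
    apply inv_anti₀ (by positivity); nlinarith [sq_nonneg (x 2 - y 2)]
  have hwc : Continuous w := by
    refine Continuous.inv₀ (by fun_prop) fun x => ?_
    positivity
  -- integrability of `|φ| w` (compact support)
  have hφw : Integrable (fun x => |φ x| * w x) volume :=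
    ((continuous_abs.comp hφ.continuous).mul hwc).integrable_of_hasCompactSupport (hφc.norm.mul_right)
  -- the majorant
  set m : EuclideanSpace ℝ (Fin 3) → ℝ := fun x =>
    (4 * π)⁻¹ * A * kernelMajorant ρ (y - x) + (2 * π)⁻¹ * (|φ x| * w x) with hm
  have hmi : Integrable m volume :=
    (((integrable_kernelMajorant ρ).comp_sub_left y).const_mul ((4 * π)⁻¹ * A)).add (hφw.const_mul _)
  -- pointwise bound of the integrand by the majorant
  have hpt : ∀ x, ‖φ x • ((4 * π * ‖y - x‖ ^ 3)⁻¹ • (y - x))‖ ≤ m x := by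
    intro x
    have hk := norm_newtonGradVec_le (y - x)
    have h0 : ‖φ x • ((4 * π * ‖y - x‖ ^ 3)⁻¹ • (y - x))‖ ≤ |φ x| * ((4 * π)⁻¹ * (‖y - x‖ ^ 2)⁻¹) := by
      rw [norm_smul, Real.norm_eq_abs]
      exact mul_le_mul_of_nonneg_left hk (abs_nonneg _)
    refine h0.trans ?_
    by_cases hyx : ‖y - x‖ < ρ
    · -- near field
      have hkm : kernelMajorant ρ (y - x) = (‖y - x‖ ^ 2)⁻¹ := by simp [kernelMajorant, indicator, hyx]
      rw [hm]; dsimp only; rw [hkm]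
      have : |φ x| * ((4 * π)⁻¹ * (‖y - x‖ ^ 2)⁻¹) ≤ A * ((4 * π)⁻¹ * (‖y - x‖ ^ 2)⁻¹) :=
        mul_le_mul_of_nonneg_right (hA x) (by positivity)
      nlinarith [this, mul_nonneg (by positivity : (0:ℝ) ≤ (2 * π)⁻¹) (mul_nonneg (abs_nonneg (φ x)) (hw0 x))]
    · -- far field: `|y-x|⁻² ≤ 2 w`
      have hyx' : ρ ≤ ‖y - x‖ := not_lt.1 hyx
      have hfar : (‖y - x‖ ^ 2)⁻¹ ≤ 2 * w x := by
        have hpos : 0 < (ρ ^ 2 + (x 2 - y 2) ^ 2) / 2 := by positivity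
        have h := norm_sub_sq_ge_half hρ.le hyx'
        calc (‖y - x‖ ^ 2)⁻¹ ≤ ((ρ ^ 2 + (x 2 - y 2) ^ 2) / 2)⁻¹ := inv_anti₀ hpos h
          _ = 2 * w x := by rw [hw]; dsimp only; rw [inv_div, div_eq_mul_inv, mul_comm]
      have hkm0 : 0 ≤ kernelMajorant ρ (y - x) := kernelMajorant_nonneg _ _
      rw [hm]; dsimp only
      have : |φ x| * ((4 * π)⁻¹ * (‖y - x‖ ^ 2)⁻¹) ≤ |φ x| * ((4 * π)⁻¹ * (2 * w x)) := by
        gcongr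
      have e : |φ x| * ((4 * π)⁻¹ * (2 * w x)) = (2 * π)⁻¹ * (|φ x| * w x) := by
        field_simp; ring
      nlinarith [this, e, mul_nonneg (by positivity : (0:ℝ) ≤ (4 * π)⁻¹ * A) hkm0]
  -- `‖G‖ ≤ ∫ m`
  have hGle : ‖G‖ ≤ A * ρ + (2 * π)⁻¹ * ∫ x, |φ x| * w x := by
    calc ‖G‖ ≤ ∫ x, ‖φ x • ((4 * π * ‖y - x‖ ^ 3)⁻¹ • (y - x))‖ := norm_integral_le_integral_norm _
      _ ≤ ∫ x, m x := integral_mono_of_nonneg (Eventually.of_forall fun x => norm_nonneg _) hmi (Eventually.of_forall hpt)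
      _ = (4 * π)⁻¹ * A * (∫ x, kernelMajorant ρ (y - x)) + (2 * π)⁻¹ * ∫ x, |φ x| * w x := by
          rw [hm, integral_add (((integrable_kernelMajorant ρ).comp_sub_left y).const_mul _) (hφw.const_mul _),
            integral_const_mul, integral_const_mul]
      _ = A * ρ + (2 * π)⁻¹ * ∫ x, |φ x| * w x := by
          rw [integral_sub_left_eq_self (kernelMajorant ρ) volume y, integral_kernelMajorant hρ.le]
          field_simp
  have hbound0 : 0 ≤ A * ρ + (2 * π)⁻¹ * ∫ x, |φ x| * w x :=
    add_nonneg (mul_nonneg hA0 hρ.le) (mul_nonneg (by positivity) (integral_nonneg fun x => mul_nonneg (abs_nonneg _) (hw0 x)))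
  refine ContinuousLinearMap.opNorm_le_bound _ hbound0 fun a => ?_
  rw [hrep a]
  exact (abs_real_inner_le_norm G a).trans (mul_le_mul_of_nonneg_right hGle (norm_nonneg _))

/-- **The anisotropic bound for the Leray corrector `∇π[G]`**, `G ∈ C^∞_c(ℝ³;ℝ³)`, `|div G| ≤ A`, `ρ > 0`:
`‖∇π[G](y)‖ ≤ A·ρ + (2π)⁻¹·∫ |div G(x)|·(ρ² + (x₂ − y₂)²)⁻¹ dx`. [folklore] -/
theorem norm_gradient_divPotential_le_anisotropic {G : EuclideanSpace ℝ (Fin 3) → EuclideanSpace ℝ (Fin 3)}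
    (hG : ContDiff ℝ (⊤ : ℕ∞) G) (hGc : HasCompactSupport G) {A : ℝ}
    (hA : ∀ x, |VectorCalculus.divergence G x| ≤ A) {ρ : ℝ} (hρ : 0 < ρ) (y : EuclideanSpace ℝ (Fin 3)) :
    ‖gradient (divPotential G) y‖ ≤
      A * ρ + (2 * π)⁻¹ * ∫ x, |VectorCalculus.divergence G x| * (ρ ^ 2 + (x 2 - y 2) ^ 2)⁻¹ := by
  set ψ : EuclideanSpace ℝ (Fin 3) → ℝ := VectorCalculus.divergence G with hψ
  have hψs : ContDiff ℝ (⊤ : ℕ∞) ψ := contDiff_divergence_of_contDiff_top hG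
  have hψc : HasCompactSupport ψ := hGc.mono' fun x hx => by
    by_contra h
    exact hx (divergence_eq_zero_of_notMem_tsupport h)
  have hpN : divPotential G = fun y => ∫ x, newtonKernel (y - x) * ψ x := funext fun y => divPotential_apply G y
  have e : gradient (divPotential G) y = (InnerProductSpace.toDual ℝ (EuclideanSpace ℝ (Fin 3))).symm (fderiv ℝ (divPotential G) y) := rfl
  rw [e, LinearIsometryEquiv.norm_map, hpN]
  exact norm_fderiv_newtonPotential_le_anisotropic hψs hψc hA hρ y

end ExtremiserLiouville

end Summit.NavierStokesRegularity.NavierStokesRegularity.Theorems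

end
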